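import Summits.SmoothPoincare4.SmoothPoincare4.Theorems.EntropyRungChangGurskyYangStubSmoothRoundLimitDecayStep
import HarnessLib

/-!
# Decay of all higher curvature derivatives of a round Type-I Ricci flow (Hamilton 1982, Thm. 17.6)
(helper `helper_curvDeriv_decay_all` = layer S3c of stub `stub_smoothRoundLimit` of line
`margerin-cone-hamilton-rails`, crux `EntropyRung.ChangGurskyYang`, item stmt-SmoothPoincare4-10834)

Hamilton 1982, §17, Thm. 17.6 (with Shi 1989, §7, in maximum-principle form): along a Ricci flow of
Riemannian metrics `g(t)` on `[0, T)` on a closed 4-manifold, write `U_k = |∇ᵏRm|²`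
(`curvDerivNormSq`) and `h = T − t`. GIVEN the scaled Shi bounds `U_k ≤ C_k h^{−k−2}` at late times
(hypothesis), the Bernstein window lemma for the pair of evolution inequalities
`∂ₜf ≤ Δf − θF + Φf`, `∂ₜF ≤ ΔF + ΦF` (hypothesis; the registered neighbour
`helper_bernsteinWindow`) and the decay `U_1 ≤ C₁ h^{δ₁−3}` of the first derivative (hypothesis;
the neighbour `helper_curvDeriv_decay_one`), ALL higher derivatives decay a power `δ' > 0` better
than scaling: for every `k`, `U_{k+1} ≤ C' h^{δ'−k−3}` at late times.

Proof (`helper_curvDeriv_decay_all`): induction on `k` carrying uniform constants `δ', C', t'` for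
`U_1, …, U_{k+1}`; the base is the hypothesis, the step is the landed helper
`helper_curvDeriv_decay_step` (`…StubSmoothRoundLimitDecayStep.lean`: the window lemma for
`f = U_{k+1}`, `F = U_{k+2}`) fed with the Shi bounds made uniform up to order `k + 2`
(`decayAll_shi_uniform`); the new exponent is `δ'/2`, and `h^{δ'−j−3} ≤ h^{δ'/2−j−3}` for `h ≤ 1`.

## References

* R. S. Hamilton, *Three-manifolds with positive Ricci curvature*, J. Differential Geom. 17
  (1982) 255–306, §13 (Thm. 13.4 ff.), §17, Thm. 17.6. [Hamilton1982]
* P. Topping, *Lectures on the Ricci flow*, LMS Lecture Note Series 325, CUP 2006, §3.3: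
  Thm. 3.3.1 with its proof, (3.3.4) (pp. 37–39). [Topping2006]
-/

noncomputable section

-- every `Summit.SmoothPoincare4.SmoothPoincare4.…` name repeats the summit = sub-problem segment (D-0017 layout)
set_option linter.dupNamespace false

open Set Function Filter
open scoped Manifold ContDiff Topology

namespace Summit.SmoothPoincare4.SmoothPoincare4.Theorems.MargerinRails

open Literature.Geometry.Riemannian
open Literature.Geometry.Lorentzian Literature.Geometry.Lorentzian.PseudoRiemannianMetric

/-- **Uniform scaled Shi bounds up to a fixed order**: from `U_k ≤ C_k ((T−t)^{k+2})⁻¹` on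
`[t_k, T)` for every `k`, one constant `S ≥ 1` and one late time serve all `p ≤ n`, in real-power
form `U_p ≤ S (T−t)^{−p−2}`. [cite: Topping2006, Thm. 3.3.1] -/
theorem decayAll_shi_uniform {α : Type*} {F : ℕ → ℝ → α → ℝ} {T : ℝ}
    (hshi : ∀ k : ℕ, ∃ C' t₁ : ℝ, t₁ ∈ Ico 0 T ∧ ∀ t ∈ Ico t₁ T, ∀ z : α,
      F k t z ≤ C' * ((T - t) ^ (k + 2))⁻¹) (n : ℕ) :
    ∃ S t₁ : ℝ, 1 ≤ S ∧ t₁ ∈ Ico 0 T ∧ ∀ p ≤ n, ∀ t ∈ Ico t₁ T, ∀ z : α,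
      F p t z ≤ S * (T - t) ^ (-(p : ℝ) - 2) := by
  -- one bound in real-power form
  have hconv : ∀ (p : ℕ) (C' t : ℝ) (z : α), t < T → F p t z ≤ C' * ((T - t) ^ (p + 2))⁻¹ →
      ∀ S, C' ≤ S → F p t z ≤ S * (T - t) ^ (-(p : ℝ) - 2) := by
    intro p C' t z ht hb S hS
    have hh : 0 < T - t := sub_pos.2 ht
    have heq : (T - t) ^ (-(p : ℝ) - 2) = ((T - t) ^ (p + 2))⁻¹ := by
      rw [show (-(p : ℝ) - 2) = -((p + 2 : ℕ) : ℝ) by push_cast; ring, Real.rpow_neg hh.le,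
        Real.rpow_natCast]
    rw [heq]
    exact hb.trans (mul_le_mul_of_nonneg_right hS (inv_nonneg.2 (pow_nonneg hh.le _)))
  induction n with
  | zero =>
    obtain ⟨C', t₁, ht₁, hb⟩ := hshi 0
    refine ⟨max C' 1, t₁, le_max_right _ _, ht₁, fun p hp t ht z ↦ ?_⟩
    obtain rfl : p = 0 := Nat.le_zero.mp hp
    exact hconv 0 C' t z ht.2 (hb t ht z) _ (le_max_left _ _)
  | succ n ih =>
    obtain ⟨S, t₁, hS, ht₁, hb⟩ := ih
    obtain ⟨C', t₂, ht₂, hb'⟩ := hshi (n + 1)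
    refine ⟨max S C', max t₁ t₂, le_max_of_le_left hS,
      ⟨le_max_of_le_left ht₁.1, max_lt ht₁.2 ht₂.2⟩, fun p hp t ht z ↦ ?_⟩
    rcases Nat.of_le_succ hp with hpn | rfl
    · have ht' : t ∈ Ico t₁ T := ⟨(le_max_left _ _).trans ht.1, ht.2⟩
      exact (hb p hpn t ht' z).trans (mul_le_mul_of_nonneg_right (le_max_left _ _)
        (Real.rpow_nonneg (sub_pos.2 ht.2).le _))
    · have ht' : t ∈ Ico t₂ T := ⟨(le_max_right _ _).trans ht.1, ht.2⟩
      exact hconv (n + 1) C' t z ht.2 (hb' t ht' z) _ (le_max_right _ _)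

/-- **HELPER S3c — DECAY OF ALL HIGHER CURVATURE DERIVATIVES (Hamilton 1982, §17, Thm. 17.6; Shi
1989, §7, in maximum-principle form).** Along a Ricci flow of Riemannian metrics on `[0, T)` on a
closed 4-manifold with the roundness rates, GIVEN the scaled Shi bounds `|∇ᵏRm|² ≤ C_k (T−t)^{−k−2}`,
the Bernstein window lemma and the decay `|∇Rm|² ≤ C₁ (T−t)^{δ₁−3}`, for every `k` there are
`δ' > 0`, `C'`, `t' ∈ [0, T)` with `|∇^{k+1}Rm|² ≤ C' (T−t)^{δ'−k−3}` on `M × [t', T)`. Proof: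
induction on `k` with uniform constants for `U_1, …, U_{k+1}` (base: the hypothesis; step:
`helper_curvDeriv_decay_step` with `decayAll_shi_uniform`, halving `δ'` and comparing powers of
`T − t ≤ 1`). [cite: Hamilton1982, §17, Thm. 17.6] [cite: Topping2006, Thm. 3.3.1] -/
theorem helper_curvDeriv_decay_all : ∀ (M : Type) [TopologicalSpace M] [T2Space M] [SecondCountableTopology M] [ChartedSpace (EuclideanSpace ℝ (Fin 4)) M] [IsManifold (𝓡 4) ∞ M] [CompactSpace M] (g : ℝ → PseudoRiemannianMetric (𝓡 4) ∞ (EuclideanSpace ℝ (Fin 4)) (TangentSpace (𝓡 4) : M → Type _)) (cov : ℝ → CovariantDerivative (𝓡 4) (EuclideanSpace ℝ (Fin 4)) (TangentSpace (𝓡 4) : M → Type _)) (T : ℝ), 0 < T → IsRicciFlow g cov (Ico 0 T) → (∀ t ∈ Ico 0 T, (g t).IsRiemannian) → ∀ (δ C t₀ : ℝ), 0 < δ → t₀ ∈ Ico 0 T → (∀ t ∈ Ico t₀ T, ∀ x : M, |(T - t) * (g t).scalarCurvatureWith (cov t) x - 2| ≤ C * (T - t) ^ δ ∧ (T - t) ^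 2 * ((g t).normSq x ((cov t).ricci x) - (g t).scalarCurvatureWith (cov t) x ^ 2 / 4) ≤ C * (T - t) ^ (2 * δ) ∧ (T - t) ^ 2 * ((g t).curvNormSqWith (cov t) x - 2 * (g t).normSq x ((cov t).ricci x) + (g t).scalarCurvatureWith (cov t) x ^ 2 / 3) ≤ C * (T - t) ^ δ) → (∀ k : ℕ, ∃ C' t₁ : ℝ, t₁ ∈ Ico 0 T ∧ ∀ t ∈ Ico t₁ T, ∀ z : M, curvDerivNormSq (𝓡 4) g k t z ≤ C' * ((T - t) ^ (k + 2))⁻¹) → (∀ (θ : ℝ) (f F Φf ΦF : ℝ → M → ℝ), 0 < θ → ContMDiffOn ((𝓡 4).prod 𝓘(ℝ, ℝ)) 𝓘(ℝ, ℝ) ∞ (fun p : M × ℝ ↦ f p.2 p.1) (univ ×ˢ Ico 0 T) → ContMDiffOn ((𝓡 4).prod 𝓘(ℝ, ℝ)) 𝓘(ℝ, ℝ) ∞ (fun p : M × ℝ ↦ F p.2 p.1) (univ ×ˢ Ico 0 T) → (∀ t ∈ Ico 0 T, ∀ x : M, 0 ≤ f t x) → (∀ t ∈ Ico 0 T, ∀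 x : M, 0 ≤ F t x) → (∀ t ∈ Ico 0 T, ∀ x : M, derivWithin (fun s ↦ f s x) (Ico 0 T) t ≤ (g t).laplaceBeltrami (f t) x - θ * F t x + Φf t x) → (∀ t ∈ Ico 0 T, ∀ x : M, derivWithin (fun s ↦ F s x) (Ico 0 T) t ≤ (g t).laplaceBeltrami (F t) x + ΦF t x) → ∀ (t₁ τ K a b A₀ : ℝ), t₁ ∈ Ico 0 T → 0 < τ → t₁ + τ < T → 0 ≤ K → 0 ≤ a → 0 ≤ b → K * τ ≤ 1 → (∀ x : M, f t₁ x ≤ A₀) → (∀ t ∈ Icc t₁ (t₁ + τ), ∀ x : M, Φf t x ≤ a) → (∀ t ∈ Icc t₁ (t₁ + τ), ∀ x : M, ΦF t x ≤ K * F t x + b) → ∀ t ∈ Icc t₁ (t₁ + τ), ∀ x : M, (t - t₁) * F t x ≤ 2 / θ * A₀ + τ * (τ * b + 2 * a / θ)) → (∃ δ₁ C₁ t₁ : ℝ, 0 < δ₁ ∧ t₁ ∈ Ico 0 T ∧ ∀ t ∈ Ico t₁ T, ∀ x : M, curvDerivNormSq (𝓡 4) g 1 t x ≤ C₁ * (T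 - t) ^ (δ₁ - 3)) → ∀ k : ℕ, ∃ δ' C' t' : ℝ, 0 < δ' ∧ t' ∈ Ico 0 T ∧ ∀ t ∈ Ico t' T, ∀ x : M, curvDerivNormSq (𝓡 4) g (k + 1) t x ≤ C' * (T - t) ^ (δ' - k - 3) := by
  intro M _ _ _ _ _ _ g cov T hT hflow hR _ _ _ _ _ _ hshi hW h1 k
  -- uniform decay of `U_1, …, U_{k+1}` by induction on `k`
  have main : ∀ k : ℕ, ∃ δ' C' t' : ℝ, 0 < δ' ∧ t' ∈ Ico 0 T ∧ ∀ j ≤ k, ∀ t ∈ Ico t' T, ∀ x : M,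
      curvDerivNormSq (𝓡 4) g (j + 1) t x ≤ C' * (T - t) ^ (δ' - j - 3) := by
    intro k
    induction k with
    | zero =>
      obtain ⟨δ₁, C₁, t₁, hδ₁, ht₁, hb⟩ := h1
      refine ⟨δ₁, C₁, t₁, hδ₁, ht₁, fun j hj t ht x ↦ ?_⟩
      obtain rfl : j = 0 := Nat.le_zero.mp hj
      simpa only [Nat.cast_zero, sub_zero, zero_add] using hb t ht x
    | succ k ih =>
      obtain ⟨δ', C', t', hδ', ht', hb⟩ := ih
      obtain ⟨S, tS, hS1, htS, hShi⟩ := decayAll_shi_uniform hshi (k + 2)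
      obtain ⟨C'', t'', ht'', hb''⟩ := helper_curvDeriv_decay_step M g cov T hT hflow hR hW k S tS
        δ' C' t' hS1 htS hShi hδ' ht' hb
      refine ⟨δ' / 2, max (max C' C'') 0, max (max t' t'') (T - 1), half_pos hδ',
        ⟨le_max_of_le_left (le_max_of_le_left ht'.1), max_lt (max_lt ht'.2 ht''.2) (by linarith)⟩,
        fun j hj t ht x ↦ ?_⟩
      have htT : 0 < T - t := sub_pos.2 ht.2
      have ht1 : T - t ≤ 1 := by linarith [(le_max_right (max t' t'') (T - 1)).trans ht.1]
      have hC0 : 0 ≤ max (max C' C'') 0 := le_max_right _ _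
      rcases Nat.of_le_succ hj with hjk | rfl
      · have htj : t ∈ Ico t' T := ⟨((le_max_left _ _).trans (le_max_left _ _)).trans ht.1, ht.2⟩
        calc _ ≤ C' * (T - t) ^ (δ' - j - 3) := hb j hjk t htj x
          _ ≤ max (max C' C'') 0 * (T - t) ^ (δ' - j - 3) :=
            mul_le_mul_of_nonneg_right ((le_max_left _ _).trans (le_max_left _ _))
              (Real.rpow_nonneg htT.le _)
          _ ≤ max (max C' C'') 0 * (T - t) ^ (δ' / 2 - j - 3) :=
            mul_le_mul_of_nonneg_left (Real.rpow_le_rpow_of_exponent_ge htT ht1 (by linarith)) hC0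
      · have htj : t ∈ Ico t'' T := ⟨((le_max_right _ _).trans (le_max_left _ _)).trans ht.1, ht.2⟩
        calc _ ≤ C'' * (T - t) ^ (δ' / 2 - k - 4) := hb'' t htj x
          _ ≤ max (max C' C'') 0 * (T - t) ^ (δ' / 2 - k - 4) :=
            mul_le_mul_of_nonneg_right ((le_max_right _ _).trans (le_max_left _ _))
              (Real.rpow_nonneg htT.le _)
          _ = max (max C' C'') 0 * (T - t) ^ (δ' / 2 - ↑(k + 1) - 3) := by
            congr 1
            push_cast
            ring
  obtain ⟨δ', C', t', hδ', ht', hb⟩ := main k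
  exact ⟨δ', C', t', hδ', ht', fun t ht x ↦ hb k le_rfl t ht x⟩

end Summit.SmoothPoincare4.SmoothPoincare4.Theorems.MargerinRails

end
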